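import Summits.Langlands.Langlands.Theses.AbelianSurfaceSerre
import Literature.NumberTheory.Automorphic.GLnAdelicStructureProofs
import Summits.Langlands.Langlands.Theorems.DyadicOddResidueSectorComplementRigidityTransport

/-!
# Disproof of `SurfaceSectorComplement` — findings (crux stmt-Langlands-17767, route AbelianSurfaceSerre)

ITEM. `Summit.Langlands.Langlands.Theses.AbelianSurfaceSerre.SurfaceSectorComplement : Prop :=
EndTrivialSurfacesModular → _root_.Langlands` (crux rank 4; the route's declared COMPLEMENT OF THE
SECTOR: "the rest of the summit — every `n ≠ 4`, every `F ≠ ℚ`, direction (A), local–global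
compatibility at every place, the reciprocity data `𝓡`, every `ρ` not of abelian-surface type …
never staff it from this route; implied by `Langlands` trivially").  Below `C` is the crux, `X` the
route target `EndTrivialSurfacesModular` (every abelian surface `A/ℚ` with `End_ℚ A = ℤ` is modular:
for every `p`, every framing `r` of `H¹_ét(A_ℚ̄, ℚ̄_p) = (V_p A)^∨`, every `hcpt`, `ι`, an L-algebraic
cuspidal `π` on `GL₄(𝔸_ℚ)` with a.e. Satake–Frobenius matching, `m = 1`), `L` the summit `Langlands`.

VERDICT OF THE DISPROVER (seat refuter-cdisprove-stmt-Langlands-17767-0, cycle 1, 2026-08-17):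
NO KILL, and none is reachable short of (i) PROVING `X` (the goal of the Boxer–Calegari–Gee–Pilloni
programme, open; as typed it needs genuine terms of `CuspidalAutomorphicRepData 4 ℚ hcpt` — Borel–
Jacquet data `W' < W ≤ 𝒜₀(GL₄)` on genuine cusp forms — which the tree cannot construct) AND
(ii) REFUTING the audited summit statement `_root_.Langlands`.  Kernel-checked in this file
(0 `sorry`; nothing here asserts `C`, `X` or `L`):

* §1 LOGICAL POSITION — `not_crux_iff : ¬ C ↔ X ∧ ¬ L`; `not_langlands_of_not_crux : ¬ C → ¬ L`;
  truth table `crux_iff_not_or : C ↔ ¬ X ∨ L`; `crux_of_langlands : L → C`;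
  `crux_iff_langlands_of_target : X → (C ↔ L)`.
* §2 EXACTNESS OF THE COMPLEMENT, and the one point where THIS frame differs from its siblings
  (`Cruxes/SectorComplement/Disproof.lean`, parts EGK 18275 / DOR 18745, whose sectors carry
  "irreducible" and "crystalline" as hypotheses and are therefore literally inside the summit):
  `X` is inside `L` only MODULO `SurfaceFramingsIrreducibleGeometric` (H_F) = "every framing `r` of
  `H¹` of an End-trivial abelian surface is irreducible (Faltings 1983: `End_ℚ A ⊗ ℚ_p = End_Γ(V_p A)`,
  semisimplicity ⇒ `End_ℚ A = ℤ` gives absolute irreducibility) and geometric for Fontaine's pinned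
  datum (Néron–Ogg–Shafarevich / smooth proper base change: unramified at good `v ∤ p`; de Rham at
  `v ∣ p`: Fontaine–Messing, Faltings 1989, Tsuji)" — none of which the tree proves for
  `AbelianVariety.rationalTateRep`.  Checked: `target_of_langlands_of_framings : H_F → L → X`,
  `langlands_iff_target_and_crux_of_framings : H_F → (L ↔ X ∧ C)`,
  `not_langlands_of_not_target_of_framings : H_F → ¬ X → ¬ L`.  CONSEQUENCES for would-be disprovers:
  (a) the matching clause of `X` is VERBATIM the summit's `SatakeFrobCompatibleAt ι π.1 r v` (`m = 1`,
  L-algebraic `π`, arithmetic Frobenius; `satakeClause_iff` is `Iff.rfl`) — no normalisation drift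
  between target and summit to exploit; (b) WITHOUT H_F a refutation of `X` as typed (the planner's
  typed risk: API junk in `rationalTateRep`'s topology / `HasSatakeParamAt` making `∃ π` unsatisfiable
  for some framing) would NOT touch the summit and would PROVE this crux ex falso
  (`crux_of_not_target`); WITH H_F it refutes the summit.  Either way `C` is never refuted through `X`.
* §3 LOAD-BEARING ANALYSIS — `C` has exactly ONE hypothesis, `X`.  `SurfaceSectorComplementWithout
  Target := L` (drop it) is the summit itself; the protocol's `_false_without_target` lemma would be
  `¬ Langlands` and is NOT available (statement audits 2026-08-14, 2026-08-16).  How much `X` bears: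
  `withoutTarget_iff_of_framings : H_F → (C-without-X ↔ X ∧ C)` — exactly `X`, no more.  Under the
  route's other items (K1 `SerreGSp4Surjective`, K2 `QuadraticImprimitiveSurfaces`, support
  `BCGPSerreReduction`) `C ↔ L` (`crux_iff_langlands_of_cruxes`, = the route's `closes`): once they
  land this item IS the summit.  What the frame carries that `X` never touches, made explicit:
  `crux_directionA_debt` (direction (A) for every `n`, `F` — in particular Galois representations
  with local–global compatibility at EVERY place for the very `π` that `X` produces),
  `crux_localLanglandsDebt` (a local Langlands datum for `GL_n(F_v)` at every finite place of every
  number field), `crux_otherRank_debt` (both directions for every `n ≠ 4` / `F ≠ ℚ`).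
* §4 STRENGTHENINGS / JUNK MODELS / FINITE MODELS — `C` has NO binders (an implication between two
  closed Props): degenerate-instance, quantifier-order, `decide`/`native_decide` and `kit compute`
  attacks do not exist at `C`; every strengthening of shape `X' → L'` inside the cone needs a PROOF of
  `X'` to be refuted, and every `X' ⊆ X` is as unconstructible as `X`.  Vacuity probes (checked
  `example`s): `hcpt` is INHABITED (`isCompact_glFiniteIntegralLevel_holds 4 ℚ`, a theorem), so neither
  `X`'s `∀ hcpt` nor the summit's is vacuous; the summit's rank guard `0 < n` excludes the `n = 0`
  pattern of `ledger negatives` 17212/16822; `AbelianVariety ℚ` (proper geometrically-integral group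
  scheme, Mumford §4) and `CuspidalAutomorphicRepData` have no `PUnit`/zero inhabitant.  Paper probes of
  the summit corners named by the planner ("even ρ, λ = 1/4 Maass π"): as recorded by the sibling seats
  (EGK §4 (a)–(d): `n = 1` Frobenius convention of `canonicalArtin` = Deligne's, consistent with
  `arithFrobPolyOfSatake ι q 1 α`; even/irregular cases are the conjecture itself, not typed
  over-claims; uniqueness in (A) fine by Brauer–Nesbitt) — re-read here against
  `LocalClassFieldTheory.lean` ll. 84–170 (geometric Frobenius ↦ uniformiser) — nothing bites.
  Barrier catalogue `Literature/Barriers/Langlands/*`: every barrier applies to `C` as a whole (it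
  contains each blocked region) and to no lever, because `C` has no lever.
* §5 `-- Targets`: payload `targets = []`, `stuck_stubs = []` at seat start (06:45Z; skelvet BLOCKED
  06:43Z).  Pre-emptive remarks on the round-1 typed first lemmas (`IsFactorAE` ≠ constituent;
  archimedean-blindness of `X`) for whichever become stubs; the five round-1 idea cards all type REGIONS
  `X → R` of the seam and leave `L` minus region as the residual stub, consistent with §3.
* §6 LINE `Sketch` (lead prover-line-stmt-Langlands-17767-0 PICKED it 06:45Z, skeleton
  `Lines/Sketch.lean` registered 07:24Z; stubs S1 `stub_recRigidity` [delegated to line 18745], S2a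
  `stub_reciprocityTRCM_of_sector`, S2b/S2c = items 1094/1095 verbatim): NO STUB BROKEN —
  `langlands_implies_stubS2a/b/c` (each S2 stub is implied by the summit, hence irrefutable short of
  `¬ Langlands`), `crux_implies_stubS2a` (`¬ S2a → X ∧ ¬ L`); MUTATION: S1 is over-strong —
  `crux_of_stubs_weak : S1ʷ → S2a → S2b → S2c → C` with S1ʷ = rigidity on local components of
  L-ALGEBRAIC cuspidal `π` only (`globalLanglands_transport_weak`); stub-note to the lead: restate S1
  with `π.1.IsLAlgebraic →` (truth value in print unchanged; makes every stub ≤ summit mod Chebotarev/BN)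
  — ADOPTED by the continuation lead c1 (PICKED.md c1: S1 reshaped to S1ʷ).  LANDING (Negative lane,
  `--supports stmt-Langlands-17767`, proposal p148491, ACCEPTED 2026-08-17): `Theorems/SurfaceSectorComplement/
  Negative/AbelianSurfaceSerreLineSketchStubsVersusSummit.lean` — `¬ S2a/¬ S2b/¬ S2c → ¬ Langlands`,
  `¬ S2a → ¬ C` (stubs inline, verbatim).

IN THE TREE ALREADY (importable; besides p148491 above this seat lands nothing further this cycle because
its remaining Negative-side content coincides): `Theorems/AbelianSurfaceSerreSurfaceSectorComplementPosition.lean` (p146326,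
prover-line seat, accepted 2026-08-17T07:20Z) — `abelianSurfaceSerre_not_surfaceSectorComplement_iff`,
`…_not_langlands_of_not_surfaceSectorComplement`, `…_surfaceSectorComplement_iff_not_or`,
`…_surfaceSectorComplement_of_langlands / _of_not_target / _iff_of_target / _iff_of_cruxes`,
`abelianSurfaceSerre_target_of_langlands` (= §2 below with H_F stated `𝓡`-free through
`fontainePstAdicCompletion`), `…_langlands_iff_target_and_surfaceSectorComplement`,
`…_surfaceSectorComplement_localLanglandsDebt`.  A dry-run of this seat's own position file bounced
`dedup.fqn-exists/dedup.landed` against it (07:28Z), as it should.  The theorems below are kept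
self-contained (own namespace) as the disprover's work record.
-/

set_option linter.dupNamespace false

namespace Summit.Langlands.Langlands.Cruxes.SurfaceSectorComplement.Disproof

open Summit.Langlands.Langlands.Theses.AbelianSurfaceSerre

/-! ## §1 Logical position of the crux -/

/-- Readback (elaboration probe, sorry-free): the crux is by definition `X → L`. [folklore] -/
theorem crux_iff_imp : SurfaceSectorComplement ↔ (EndTrivialSurfacesModular → _root_.Langlands) :=
  Iff.rfl

/-- The summit implies the frame (discard the sector hypothesis; the planner's "BC2 converse").
[folklore] -/
theorem crux_of_langlands : _root_.Langlands → SurfaceSectorComplement :=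
  fun h _ ↦ h

/-- Truth table: `C ↔ ¬ X ∨ L`. [folklore] -/
theorem crux_iff_not_or : SurfaceSectorComplement ↔ ¬ EndTrivialSurfacesModular ∨ _root_.Langlands :=
  imp_iff_not_or

/-- EXACT CONTENT OF A DISPROOF: `¬ C ↔ X ∧ ¬ L` — prove the open sector theorem (modularity of all
End-trivial abelian surfaces over `ℚ`) AND refute the formal summit. [folklore] -/
theorem not_crux_iff : ¬ SurfaceSectorComplement ↔ EndTrivialSurfacesModular ∧ ¬ _root_.Langlands :=
  Classical.not_imp

/-- Any disproof of the frame is a disproof of the summit statement. [folklore] -/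
theorem not_langlands_of_not_crux : ¬ SurfaceSectorComplement → ¬ _root_.Langlands :=
  mt crux_of_langlands

/-- … and a proof of the route target. [folklore] -/
theorem target_of_not_crux : ¬ SurfaceSectorComplement → EndTrivialSurfacesModular :=
  fun h ↦ (not_crux_iff.1 h).1

/-- Ex falso: were the target FALSE as typed, the frame would be TRUE. [folklore] -/
theorem crux_of_not_target : ¬ EndTrivialSurfacesModular → SurfaceSectorComplement :=
  fun hX h ↦ (hX h).elim

/-- Under the route target the frame is literally the summit. [folklore] -/
theorem crux_iff_langlands_of_target (hX : EndTrivialSurfacesModular) :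
    SurfaceSectorComplement ↔ _root_.Langlands :=
  ⟨fun hC ↦ hC hX, fun h _ ↦ h⟩

/-! ## §2 Exactness of the complement: the sector is inside the summit MODULO Faltings + geometricity -/

/-- No normalisation drift: the matching clause of the target is, place by place, the summit's
`SatakeFrobCompatibleAt ι π.1 r v` (L-normalisation `m = 1`, arithmetic Frobenius). [folklore] -/
theorem satakeClause_iff {p : ℕ} [Fact p.Prime]
    {hcpt : Literature.NumberTheory.Automorphic.isCompact_glFiniteIntegralLevel 4 ℚ}
    (ι : PadicAlgCl p ≃+* ℂ) (π : Literature.NumberTheory.Automorphic.CuspidalAutomorphicRepData 4 ℚ hcpt)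
    (r : Literature.NumberTheory.GaloisRepresentations.FramedGaloisRep ℚ (PadicAlgCl p) 4)
    (v : IsDedekindDomain.HeightOneSpectrum (NumberField.RingOfIntegers ℚ)) :
    Summit.Langlands.SatakeFrobCompatibleAt ι π.1 r v ↔
      ∃ a : Multiset ℂ, π.1.HasSatakeParamAt v a ∧ r.IsUnramifiedAt v ∧
        r.HasFrobCharpolyAt v
          (Literature.NumberTheory.Automorphic.arithFrobPolyOfSatake ι v.residueCard 1 a) :=
  Iff.rfl

/-- **H_F — the two inputs the summit does not supply for the target's framings.**  For every abelian
surface `A/ℚ` with `End_ℚ A = ℤ`, every prime `p` and every framing `r` of `(V_p A)^∨ ⊗ ℚ̄_p`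
(contragredient of the rational Tate representation in a `ℚ_p`-basis `b`): `r` is irreducible
(Faltings 1983, Tate conjecture + semisimplicity: `End_ℚ A = ℤ` ⇒ `V_p A ⊗ ℚ̄_p` absolutely
irreducible) and geometric for every reciprocity datum (unramified at the cofinitely many good
`v ∤ p`: Néron–Ogg–Shafarevich / smooth proper base change; de Rham at `v ∣ p` for Fontaine's pinned
`D_pst` datum: Fontaine–Messing, Faltings, Tsuji).  TRUE in print; NOT derivable in the tree for
`AbelianVariety.rationalTateRep` (no comparison theorems).  Used only as a hypothesis.
[cite: Faltings1983, Satz 3–4] -/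
def SurfaceFramingsIrreducibleGeometric : Prop :=
  ∀ (A : Literature.AlgebraicGeometry.Motives.AbelianVariety ℚ), A.dim = 2 →
    (∀ f : A ⟶ A, ∃ n : ℤ, f = n • CategoryTheory.CategoryStruct.id A) →
    ∀ (p : ℕ) [Fact p.Prime] (b : Module.Basis (Fin 4) ℚ_[p] (A.rationalTateModule p))
      (r : Literature.NumberTheory.GaloisRepresentations.FramedGaloisRep ℚ (PadicAlgCl p) 4),
      (∀ g : Field.absoluteGaloisGroup ℚ, (r g).val =
        ((LinearMap.toMatrix b b (A.rationalTateRep p g⁻¹)).map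
          (algebraMap ℚ_[p] (PadicAlgCl p))).transpose) →
      r.toGaloisRep.IsIrreducible ∧
        ∀ 𝓡 : Summit.Langlands.ReciprocityData ℚ, Summit.Langlands.IsGeometricFramed 𝓡 r

/-- **Modulo H_F the target is a consequence of the summit as typed**: `H_F → L → X` — direction (B)
of `Langlands` at `F = ℚ`, `n = 4`, `ℓ = p`, for the reciprocity data supplied by the summit's own
non-vacuity conjunct; the Satake half of `Corresponds` is the target's conclusion verbatim
(`satakeClause_iff`).  The proof never uses `A.dim = 2`, the basis or the framing equation except to
feed H_F. [folklore] -/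
theorem target_of_langlands_of_framings (hF : SurfaceFramingsIrreducibleGeometric)
    (hL : _root_.Langlands) : EndTrivialSurfacesModular := by
  intro A hdim hEnd p _ b r hr hcpt ι
  obtain ⟨⟨𝓡⟩, h⟩ := hL ℚ
  have hB : Summit.Langlands.GaloisToAutomorphic 4 𝓡 hcpt := (h 𝓡 4 (by norm_num) hcpt).2
  obtain ⟨hirr, hgeo⟩ := hF A hdim hEnd p b r hr
  obtain ⟨π, hLalg, hcorr⟩ := hB p ι r hirr (hgeo 𝓡)
  exact ⟨π, hLalg, hcorr.1⟩

/-- **Bookkeeping identity modulo H_F**: `L ↔ X ∧ C`.  (For the sibling frames EGK/DOR this holds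
outright; here H_F is genuinely needed — the target has no irreducibility/geometricity clause.)
[folklore] -/
theorem langlands_iff_target_and_crux_of_framings (hF : SurfaceFramingsIrreducibleGeometric) :
    _root_.Langlands ↔ EndTrivialSurfacesModular ∧ SurfaceSectorComplement :=
  ⟨fun h ↦ ⟨target_of_langlands_of_framings hF h, fun _ ↦ h⟩, fun h ↦ h.2 h.1⟩

/-- Modulo H_F a counterexample to the target refutes the summit (and proves this crux):
`H_F → ¬ X → ¬ L ∧ C`. [folklore] -/
theorem not_langlands_of_not_target_of_framings (hF : SurfaceFramingsIrreducibleGeometric)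
    (hX : ¬ EndTrivialSurfacesModular) : ¬ _root_.Langlands ∧ SurfaceSectorComplement :=
  ⟨fun hL ↦ hX (target_of_langlands_of_framings hF hL), crux_of_not_target hX⟩

/-! ## §3 Load-bearing analysis (one hypothesis, the target `X`) -/

/-- `SurfaceSectorComplement` with its only hypothesis DROPPED: the summit statement itself.  (The
protocol's `crux_false_without_target : ¬ SurfaceSectorComplementWithoutTarget` would be `¬ Langlands`;
it is not available and is deliberately NOT stated, not even with `sorry`.) [folklore] -/
def SurfaceSectorComplementWithoutTarget : Prop := _root_.Langlands

/-- Dropping the hypothesis costs exactly the target (modulo H_F): `C-without-X ↔ X ∧ C`. [folklore] -/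
theorem withoutTarget_iff_of_framings (hF : SurfaceFramingsIrreducibleGeometric) :
    SurfaceSectorComplementWithoutTarget ↔ EndTrivialSurfacesModular ∧ SurfaceSectorComplement :=
  langlands_iff_target_and_crux_of_framings hF

/-- The route's other items give the target (body of the printed reduction, restated so that nothing
positive is asserted unconditionally). [folklore] -/
theorem target_of_cruxes (h₁ : SerreGSp4Surjective) (h₂ : QuadraticImprimitiveSurfaces)
    (hR : BCGPSerreReduction) : EndTrivialSurfacesModular :=
  hR h₁ h₂

/-- … so once K1, K2 and the support land, this item IS the summit: `C ↔ L` (`→` is the route's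
sorry-free `closes`). [folklore] -/
theorem crux_iff_langlands_of_cruxes (h₁ : SerreGSp4Surjective) (h₂ : QuadraticImprimitiveSurfaces)
    (hR : BCGPSerreReduction) : SurfaceSectorComplement ↔ _root_.Langlands :=
  ⟨fun hC ↦ closes h₁ h₂ hR hC, fun h _ ↦ h⟩

/-- What the frame carries that `X` never touches (1): DIRECTION (A) for every rank and every number
field — in particular irreducible geometric Galois representations with local–global compatibility
at EVERY finite place for the very `π` on `GL₄(𝔸_ℚ)` that `X` produces (X asserts a.e. Satake
matching only). [folklore] -/
theorem crux_directionA_debt (hC : SurfaceSectorComplement) (hX : EndTrivialSurfacesModular)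
    (F : Type) [Field F] [NumberField F] (𝓡 : Summit.Langlands.ReciprocityData F) (n : ℕ)
    (hn : 0 < n) (hcpt : Literature.NumberTheory.Automorphic.isCompact_glFiniteIntegralLevel n F) :
    Summit.Langlands.AutomorphicToGalois n 𝓡 hcpt :=
  ((hC hX F).2 𝓡 n hn hcpt).1

/-- What the frame carries that `X` never touches (2): a local Langlands datum for `GL_n(F_v)` at
EVERY finite place of EVERY number field (the Harris–Taylor/Henniart debt of `𝓡`). [folklore] -/
theorem crux_localLanglandsDebt (hC : SurfaceSectorComplement) (hX : EndTrivialSurfacesModular)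
    (F : Type) [Field F] [NumberField F]
    (v : IsDedekindDomain.HeightOneSpectrum (NumberField.RingOfIntegers F)) :
    Nonempty (Literature.NumberTheory.Automorphic.LocalLanglandsDatum (v.adicCompletion F)) := by
  obtain ⟨⟨𝓡⟩, -⟩ := hC hX F
  exact ⟨𝓡.llc v⟩

/-- What the frame carries that `X` never touches (3): BOTH directions for every `n ≥ 1` and every
`F` (e.g. `n = 2`, `F = ℚ`: weight-one / Maass `λ = 1/4` forms and even `ρ`; every `F ≠ ℚ`).
[folklore] -/
theorem crux_otherRank_debt (hC : SurfaceSectorComplement) (hX : EndTrivialSurfacesModular)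
    (F : Type) [Field F] [NumberField F] (𝓡 : Summit.Langlands.ReciprocityData F) (n : ℕ)
    (hn : 0 < n) (hcpt : Literature.NumberTheory.Automorphic.isCompact_glFiniteIntegralLevel n F) :
    Summit.Langlands.GlobalLanglandsCorrespondenceGLn n F 𝓡 hcpt :=
  (hC hX F).2 𝓡 n hn hcpt

/-! ## §4 Natural strengthenings / junk models / vacuity probes

`C` has no binders; nothing finite to decide.  The probes below certify that the two `∀ hcpt`
quantifiers (target and summit) range over an INHABITED type and that the summit's rank guard excludes
the `n = 0` junk pattern of the negatives index. -/

/-- `hcpt` is inhabited: `GL₄(𝒪̂_ℚ)` is compact open (a theorem of the tree), so `∀ hcpt` is not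
vacuous in `X` nor in `L`. [folklore] -/
example : Literature.NumberTheory.Automorphic.isCompact_glFiniteIntegralLevel 4 ℚ :=
  Literature.NumberTheory.Automorphic.isCompact_glFiniteIntegralLevel_holds 4 ℚ

/-- The frame + target instantiate the summit at the target's own parameters `F = ℚ`, `n = 4`
(rank guard `0 < 4` discharged), where direction (B) RE-PROVES nothing about `X` unless H_F is
available (§2) — the frame is not "X plus the rest" but "all of L". [folklore] -/
example (hC : SurfaceSectorComplement) (hX : EndTrivialSurfacesModular)
    (𝓡 : Summit.Langlands.ReciprocityData ℚ)
    (hcpt : Literature.NumberTheory.Automorphic.isCompact_glFiniteIntegralLevel 4 ℚ) :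
    Summit.Langlands.GaloisToAutomorphic 4 𝓡 hcpt :=
  ((hC hX ℚ).2 𝓡 4 (by norm_num) hcpt).2

/-! ## §5 Targets (lead's stuck stubs)

`targets = []`, `stuck_stubs = []`, no `PICKED.md`, no registered skeleton for stmt-Langlands-17767
(2026-08-17T06:45Z).  Nothing to attack yet; on re-arm, stubs `Yᵢ` of a picked line are tested first
for COSTUME (`Yᵢ → C` by `fun h _ ↦ …`, i.e. `Yᵢ` restates the summit off the sector) and then by
hypothesis mutation.

PRE-EMPTIVE REMARKS on the round-1 typed first lemmas (`Sketch_r1_k1.lean`, `Sketch_r1_k2.lean`; paper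
checks only, no lemma filed — they are not stubs yet):

* Every candidate line has the shape `X ∧ (regions R(X)) ∧ Y → L` with `Y ⊇ L` minus the regions; by
  §3 such a `Y` is summit-hard (contains (A) for all `n`, every `F ≠ ℚ`, LGC at every place), so no line
  on this crux can close before the summit does — consistent with the planner's "never staff".
* `CyclicDeinductionPackage` (k1 §3): its hypothesis `IsFactorAE (r.restrictField K) ρ` is EIGENVALUE
  DIVISIBILITY a.e., not "ρ is a constituent of `r|_K`".  In general divisibility of Frobenius
  polynomials a.e. does NOT give a constituent (e.g. `charpoly (σ ⊗ det σ) ∣ charpoly (Sym³ σ)` at every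
  unramified place — eigenvalues `α²β, αβ²` among `α³, α²β, αβ², β³` — while `σ ⊗ det σ ⊄ Sym³ σ`), so
  the package's proof needs MORE than "Frobenius reciprocity + Chebotarev + Brauer–Nesbitt": for `r` an
  `H¹`-framing of an End-trivial surface it goes through (i) `r` absolutely irreducible (Faltings) ⇒
  `r|_K` has no character and is reducible iff `r ≅ Ind_K^ℚ ρ₀`, and (ii) a Goursat/Zariski-closure
  argument on `(ρ₀ ⊕ ρ₀^σ, ρ)` plus Hodge–Tate weights `{0,1}` to force `ρ^{ss} ∈ {ρ₀, ρ₀^σ}`.  The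
  package looks TRUE as typed (no counterexample found among types A, B[C₂], potentially-CM End-trivial
  surfaces), but a stub stated with `IsFactorAE` inherits this extra proof debt; stating the region with
  `¬ (r.restrictField K).IsIrreducible` (as the sibling crux `QuadraticImprimitiveSurfaces` does) avoids it.
* `HalfTwistBridge` / the de-induction's step (iv) and the k2 finding "X is archimedean-blind": `X`
  gives `π.1.IsLAlgebraic` only, and the tree's `HasInfinityType` reads the HC `a`-multisets per
  embedding, not the pairing `(a_i, b_i)` (documented design: `AutomorphicRepsGL` D3,
  `HodgeInfinityType.lean` design notes — the pairing is carried by the witness `T`); for CUSPIDAL `π`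
  the pairing is recovered by Clozel's purity lemma (Clozel 1990, Lemme 4.9) and, at real places, by
  swap-stability, so `HasHodgeInfinityType 1 {0,0,1,1}` (X_hol) does pin `Π_∞` in print — but under
  `X` alone the `a`-multiset itself is
  NOT pinned by a.e. Satake matching with `H¹(A)` without further input: purity + L-algebraicity +
  `|α| = q^{∓1/2}` leave `Π_∞ = Ind(z^{p₁} z̄^{1-p₁}) ⊕ Ind(z^{p₂} z̄^{1-p₂})`, `pᵢ ∈ ℤ`; REGULAR exotic
  types are killed by HLTT + Caraiani's HT weights against Faltings' `{0,0,1,1}` for `H¹(A)`; the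
  NON-regular exotic types `p₁ = p₂ ∉ {0,1}` (Siegel weight `(k,2)`, `k ≥ 3`, after transfer) need the
  low-weight Galois representations of Taylor 1991 / Mok 2014 WITH their Hodge–Tate weights — an input no
  round-1 card lists.  So a stub "L-algebraic `π` matching `ρ_E^∨` a.e. ⇒ `E` modular (weight 0)" is not
  theorem-grade as typed unless `π_∞` is pinned (`X_hol`) or that input is added — flag for the lead:
  `stub-misstated` risk, repair = carry `HasInfinityType` through the line (the k2 card's `stub_archType`). -/


/-! ## §6 Line `Sketch` (PICKED.md 06:45Z; skeleton `Lines/Sketch.lean`, lead prover-line-stmt-Langlands-17767-0):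
stub attacks

Registered stubs (verbatim copies below as `Prop`s, from `Lines/Sketch.lean` @ 2026-08-17T07:24Z):
S1 `stub_recRigidity` (rigidity of pinned reciprocity data on local components of cuspidal `π`;
DELEGATED to line 18745), S2a `stub_reciprocityTRCM_of_sector` (`X →` reciprocity over TR ∪ CM fields,
`∃ 𝓡` form; open conjecture), S2b `stub_ascentConjugationSolvable` (= item stmt-Langlands-1094 verbatim),
S2c `stub_ascentResidual` (= item stmt-Langlands-1095 verbatim).  Findings, kernel-checked below:

* COSTUME / IRREFUTABILITY — `langlands_implies_stubS2a/S2b/S2c`: each of S2a, S2b, S2c is IMPLIED BY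
  THE SUMMIT (discard the antecedent, take `𝓡` from the non-vacuity conjunct), hence irrefutable short
  of refuting `Langlands` (`not_langlands_of_not_stubS2x`); and `crux_implies_stubS2a : C → S2a`, so
  `¬ S2a → X ∧ ¬ L` exactly as for the crux.  No stub of the junction can be broken by this seat; S2a is
  the summit restricted to TR ∪ CM base fields (granted `X`, idle off `F = ℚ, n = 4, (B)`), as the lead
  declares — an honest "never closes before the summit" decomposition, not a hidden costume (`S2a → C`
  fails: needs S2b, S2c AND S1).
* JOINT SUFFICIENCY — `crux_of_stubs_weak : S1ʷ → S2a → S2b → S2c → C` re-derives the lead's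
  `SurfaceSectorComplement_of` with S1 WEAKENED to L-algebraic `π` (`StubS1Weak`): the transport
  `ReciprocityRigidity.globalLanglands_transport` consumes rigidity only at the `π` of directions (A)/(B),
  which are L-algebraic.  MUTATION RESULT: S1 is OVER-STRONG by exactly the non-algebraic cuspidal
  spectrum (Maass forms of transcendental parameter etc.), on which the summit is silent; `S1 → S1ʷ`
  trivially (`stubS1Weak_of_stubS1`).  In print both hold iff the typed `IsLocalLanglandsGL` pins `rec_n`
  on generic classes (Henniart 1993 + JPSS; the twin line's open S5/S6), so the weakening does not change
  S1's truth value — but it makes EVERY stub of the line a consequence of the summit modulo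
  Chebotarev + Brauer–Nesbitt + functoriality of the WD/`HasFrobSemisimpleClass` API (for L-algebraic `π`,
  (A) for `𝓡` and for `𝓡'` give `ρ ≅ ρ'` by a.e. Satake matching, whence equal `rec`-classes at every
  `v`), i.e. the line is then provably no harder AND no easier than the summit.  Recommendation to the
  lead (stub-note, not stub-false): restate S1 with `π.1.IsLAlgebraic →`; nothing else in the glue moves.
* S2b / S2c are other routes' filed items (1094 / 1095, route BaseFieldAscent); not re-vetted here
  (anti-leakage); their only use is modus ponens in `junctionExists_of_stubs`.
* Nothing finite / decidable in any stub; no `kit compute` job. -/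

section LineSketch

open scoped MatrixGroups NumberField
open NumberField IsDedekindDomain
open Literature.NumberTheory.Automorphic Literature.NumberTheory.GaloisRepresentations
open Summit.Langlands

/-- `Langlands_∃` over the base fields satisfying `Q` (the shape of every S2 stub's antecedent and
conclusion). [folklore] -/
def LanglandsExistsOn (Q : ∀ (F : Type) [Field F] [NumberField F], Prop) : Prop :=
  ∀ (F : Type) [Field F] [NumberField F], Q F →
    ∃ R : ReciprocityData F, ∀ n : ℕ, 0 < n →
      ∀ hcpt : isCompact_glFiniteIntegralLevel n F, GlobalLanglandsCorrespondenceGLn n F R hcpt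

/-- Base fields of S2a: totally real or CM. [folklore] -/
def IsTRCM (F : Type) [Field F] [NumberField F] : Prop :=
  NumberField.IsTotallyReal F ∨ NumberField.IsCMField F

/-- Base fields of S2b's conclusion / S2c's antecedent: conjugation-solvable (verbatim the stub's
existential). [folklore] -/
def IsConjSolvable (F : Type) [Field F] [NumberField F] : Prop :=
  ∃ (F₀ E : Type) (_ : Field F₀) (_ : NumberField F₀) (_ : Field E) (_ : NumberField E)
    (_ : Algebra F₀ F) (_ : Algebra F E) (_ : Algebra F₀ E) (_ : IsScalarTower F₀ F E)
    (_ : IsGalois F₀ E), NumberField.IsTotallyReal F₀ ∧ IsSolvable (E ≃ₐ[F₀] E)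

/-- S2a = `stub_reciprocityTRCM_of_sector` (type copied). [folklore] -/
def StubS2a : Prop := EndTrivialSurfacesModular → LanglandsExistsOn IsTRCM

/-- S2b = `stub_ascentConjugationSolvable` (type copied). [folklore] -/
def StubS2b : Prop := LanglandsExistsOn IsTRCM → LanglandsExistsOn IsConjSolvable

/-- S2c = `stub_ascentResidual` (type copied; conclusion `Langlands_∃` written without the trivial
guard). [folklore] -/
def StubS2c : Prop := LanglandsExistsOn IsConjSolvable →
  ∀ (F : Type) [Field F] [NumberField F], ∃ R : ReciprocityData F, ∀ n : ℕ, 0 < n →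
    ∀ hcpt : isCompact_glFiniteIntegralLevel n F, GlobalLanglandsCorrespondenceGLn n F R hcpt

/-- S1 = `stub_recRigidity` (type copied): rigidity on local components of ALL cuspidal `π`.
[folklore] -/
def StubS1 : Prop :=
  ∀ (K : Type) [Field K] [NumberField K] (𝓡 𝓡' : ReciprocityData K) (n : ℕ)
    (hcpt : isCompact_glFiniteIntegralLevel n K), 0 < n →
    ∀ (π : CuspidalAutomorphicRepData n K hcpt) (v : HeightOneSpectrum (𝓞 K))
      (πv : SmoothIrrep (GL (Fin n) (v.adicCompletion K))), π.1.HasLocalComponentAt v πv.ρ →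
        (𝓡.llc v).recGL n (IrrClass.mk πv) = (𝓡'.llc v).recGL n (IrrClass.mk πv)

/-- S1ʷ: the same rigidity demanded only on local components of L-ALGEBRAIC cuspidal `π` — all that
the transport of the summit consumes. [folklore] -/
def StubS1Weak : Prop :=
  ∀ (K : Type) [Field K] [NumberField K] (𝓡 𝓡' : ReciprocityData K) (n : ℕ)
    (hcpt : isCompact_glFiniteIntegralLevel n K), 0 < n →
    ∀ (π : CuspidalAutomorphicRepData n K hcpt), π.1.IsLAlgebraic → ∀ (v : HeightOneSpectrum (𝓞 K))
      (πv : SmoothIrrep (GL (Fin n) (v.adicCompletion K))), π.1.HasLocalComponentAt v πv.ρ →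
        (𝓡.llc v).recGL n (IrrClass.mk πv) = (𝓡'.llc v).recGL n (IrrClass.mk πv)

/-- The summit over ALL base fields, `∃ 𝓡` form, is a consequence of `Langlands`. [folklore] -/
theorem langlandsExistsOn_of_langlands (hL : _root_.Langlands)
    (Q : ∀ (F : Type) [Field F] [NumberField F], Prop) : LanglandsExistsOn Q := by
  intro F _ _ _
  obtain ⟨⟨𝓡⟩, hall⟩ := hL F
  exact ⟨𝓡, hall 𝓡⟩

/-- S2a is implied by the summit (antecedent `X` discarded). [folklore] -/
theorem langlands_implies_stubS2a (hL : _root_.Langlands) : StubS2a :=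
  fun _ ↦ langlandsExistsOn_of_langlands hL _

/-- S2b is implied by the summit (antecedent discarded). [folklore] -/
theorem langlands_implies_stubS2b (hL : _root_.Langlands) : StubS2b :=
  fun _ ↦ langlandsExistsOn_of_langlands hL _

/-- S2c is implied by the summit (antecedent discarded). [folklore] -/
theorem langlands_implies_stubS2c (hL : _root_.Langlands) : StubS2c := by
  intro _ F _ _
  obtain ⟨⟨𝓡⟩, hall⟩ := hL F
  exact ⟨𝓡, hall 𝓡⟩

/-- Hence each S2 stub is irrefutable short of refuting the summit. [folklore] -/
theorem not_langlands_of_not_stubS2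
    (h : ¬ StubS2a ∨ ¬ StubS2b ∨ ¬ StubS2c) : ¬ _root_.Langlands := fun hL ↦ by
  rcases h with h | h | h
  · exact h (langlands_implies_stubS2a hL)
  · exact h (langlands_implies_stubS2b hL)
  · exact h (langlands_implies_stubS2c hL)

/-- The crux itself implies S2a (through `X`): `C → S2a`; so `¬ S2a → X ∧ ¬ L`. [folklore] -/
theorem crux_implies_stubS2a (hC : SurfaceSectorComplement) : StubS2a :=
  fun hX ↦ langlandsExistsOn_of_langlands (hC hX) _

/-- … and a refutation of S2a would be a refutation of the crux, i.e. of the summit plus a proof of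
the target. [folklore] -/
theorem target_and_not_langlands_of_not_stubS2a (h : ¬ StubS2a) :
    EndTrivialSurfacesModular ∧ ¬ _root_.Langlands :=
  not_crux_iff.1 fun hC ↦ h (crux_implies_stubS2a hC)

/-- S1 trivially gives S1ʷ. [folklore] -/
theorem stubS1Weak_of_stubS1 (h : StubS1) : StubS1Weak :=
  fun K _ _ 𝓡 𝓡' n hcpt hn π _ v πv hπv ↦ h K 𝓡 𝓡' n hcpt hn π v πv hπv

/-- **Transport of `(A) ∧ (B)` in rank `n` along data that agree on the local components of the
L-ALGEBRAIC cuspidal `π` only** (mutation of `ReciprocityRigidity.globalLanglands_transport`: the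
rigidity hypothesis is consumed at `π` L-algebraic in both directions). [folklore] -/
theorem globalLanglands_transport_weak {K : Type} [Field K] [NumberField K] {n : ℕ}
    {hcpt : isCompact_glFiniteIntegralLevel n K} (𝓡 𝓡' : ReciprocityData K)
    (h : ∀ (π : CuspidalAutomorphicRepData n K hcpt), π.1.IsLAlgebraic →
      ∀ (v : HeightOneSpectrum (𝓞 K)) (πv : SmoothIrrep (GL (Fin n) (v.adicCompletion K))),
        π.1.HasLocalComponentAt v πv.ρ →
          (𝓡.llc v).recGL n (IrrClass.mk πv) = (𝓡'.llc v).recGL n (IrrClass.mk πv))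
    (hG : GlobalLanglandsCorrespondenceGLn n K 𝓡 hcpt) :
    GlobalLanglandsCorrespondenceGLn n K 𝓡' hcpt := by
  obtain ⟨hA, hB⟩ := hG
  refine ⟨fun π hLalg ℓ _ ι ↦ ?_, fun ℓ _ ι ρ hirr hgeo ↦ ?_⟩
  · obtain ⟨ρ, hirr, hgeo, hcorr, huniq⟩ := hA π hLalg ℓ ι
    exact ⟨ρ, hirr, hgeo,
      Theorems.ReciprocityRigidity.corresponds_transport 𝓡 𝓡' ι π ρ (h π hLalg) hcorr,
      fun ρ' hcorr' ↦ huniq ρ' (Theorems.ReciprocityRigidity.corresponds_transport 𝓡' 𝓡 ι π ρ'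
        (fun v πv hπv ↦ (h π hLalg v πv hπv).symm) hcorr')⟩
  · obtain ⟨π, hLalg, hcorr⟩ := hB ℓ ι ρ hirr hgeo
    exact ⟨π, hLalg,
      Theorems.ReciprocityRigidity.corresponds_transport 𝓡 𝓡' ι π ρ (h π hLalg) hcorr⟩

/-- **`Langlands ↔ Langlands_∃` already under S1ʷ.** [folklore] -/
theorem langlands_iff_exists_of_stubS1Weak (hR : StubS1Weak) :
    _root_.Langlands ↔
      ∀ (F : Type) [Field F] [NumberField F], ∃ 𝓡 : ReciprocityData F, ∀ n : ℕ, 0 < n →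
        ∀ hcpt : isCompact_glFiniteIntegralLevel n F, GlobalLanglandsCorrespondenceGLn n F 𝓡 hcpt := by
  constructor
  · intro hL F _ _
    obtain ⟨⟨𝓡⟩, hall⟩ := hL F
    exact ⟨𝓡, hall 𝓡⟩
  · intro hE F _ _
    obtain ⟨𝓡, h𝓡⟩ := hE F
    exact ⟨⟨𝓡⟩, fun 𝓡' n hn hcpt ↦
      globalLanglands_transport_weak 𝓡 𝓡' (hR F 𝓡 𝓡' n hcpt hn) (h𝓡 n hn hcpt)⟩

/-- **JOINT SUFFICIENCY WITH THE WEAKENED S1**: `S1ʷ → S2a → S2b → S2c → C` — the lead's composition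
`SurfaceSectorComplement_of` goes through verbatim with S1 restricted to L-algebraic `π`; S1 is
over-strong by exactly the non-algebraic cuspidal spectrum. [folklore] -/
theorem crux_of_stubs_weak (h1 : StubS1Weak) (h2a : StubS2a) (h2b : StubS2b) (h2c : StubS2c) :
    SurfaceSectorComplement :=
  fun hX ↦ (langlands_iff_exists_of_stubS1Weak h1).2 (h2c (h2b (h2a hX)))

/-- Sanity (the split is not circular): the crux returns the `∃`-form junction with no further
hypothesis, so `S2a ∘ S2b ∘ S2c ≤ C`; the converse direction needs S1ʷ. [folklore] -/
theorem junctionExists_of_crux (hC : SurfaceSectorComplement) (hX : EndTrivialSurfacesModular) :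
    ∀ (F : Type) [Field F] [NumberField F], ∃ 𝓡 : ReciprocityData F, ∀ n : ℕ, 0 < n →
      ∀ hcpt : isCompact_glFiniteIntegralLevel n F, GlobalLanglandsCorrespondenceGLn n F 𝓡 hcpt :=
  fun F _ _ ↦ langlandsExistsOn_of_langlands (hC hX) (fun _ _ _ ↦ True) F trivial

end LineSketch

end Summit.Langlands.Langlands.Cruxes.SurfaceSectorComplement.Disproof
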